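import Literature.Probability.Percolation.HierarchicalRenormalisationStep
import Literature.Probability.Percolation.LongRangeSharpness
import HarnessLib

/-!
# Hierarchical long-range percolation: no runaway growth of `M_B` (Hutchcroft 2022, Prop. 2.4)

Topic `Literature/Probability/Percolation`. Sequel of `HierarchicalRenormalisationStep.lean`
(Lemma 2.6) and `LongRangeSharpness.lean` (sharpness: `E_β|K(0)| < ∞` for `β < β_c`), toward the
named fact `Hutchcroft2022_twoPoint_volumeTail`:

* `sq_clusterMaxIn_le_sum_clusterCapIn`, `integral_clusterCapIn_eq_sum` ((2.11)),
  `sq_typicalMax_le_sum_real_openConn` — `(M(Λ)-1)²/e ≤ Σ_{x,y∈Λ} P(x ↔ y)`;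
* `etaLaw_real_openConn_le` — `P_{β,σ}(x ↔ y in η_B) ≤ P_β(x ↔ y)`;
* `IsGoodUpTo` — `B_k(x)` is a good child of `B_{k+1}(x)` for `n ≤ k < N` (finite-height version
  of "ancestrally good"; the runaway argument only climbs to a height depending on `β`), with
  `exists_isGoodUpTo` (descend through good children, Lemma 2.1);
* **`Mblock_sq_lt_of_isGoodUpTo`** / **`Mblock_sq_lt_of_ancestrallyGood`** — Proposition 2.4:
  `M_B² < (A/(cβ)) L^{(d+α)n}` for (sufficiently) ancestrally good `n`-blocks, `0 < β < β_c`.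

## References

* [Hutchcroft2022] T. Hutchcroft, J. Math. Phys. 63 (2022), arXiv:2202.07634, Proposition 2.4 and
  its proof (p. 10), Lemma 2.1, (2.11).
-/

noncomputable section

namespace Literature.Probability.Percolation

open Finset Literature.Probability.LatticeModels

variable {d : ℕ}

/-! ### Second moments of the maximal trace and the two-point function -/

section NoRunaway

open MeasureTheory

variable {V : Type*}

/-- **`|K_max(Λ)|² ≤ Σ_{x ∈ Λ} |K_x ∩ Λ|`** (the `|K_max|` vertices of a maximal trace each have trace
`|K_max|`; "`Σ_{x∈B_m} |K(x)| ≥ |K^max_{B_m}|²`"). [cite: Hutchcroft2022, proof of Prop. 2.4 (p. 10)] -/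
theorem sq_clusterMaxIn_le_sum_clusterCapIn (Λ : Finset V) (ω : BondConfig V) :
    clusterMaxIn Λ ω ^ 2 ≤ ∑ x ∈ Λ, clusterCapIn Λ ω x := by
  classical
  rcases Λ.eq_empty_or_nonempty with rfl | hΛ
  · simp [clusterMaxIn]
  obtain ⟨v, -, hmax⟩ := exists_clusterCapIn_eq_clusterMaxIn hΛ ω
  set D := Λ.filter fun z => (openGraph ω).Reachable v z with hD
  have hDcard : D.card = clusterMaxIn Λ ω := by rw [hmax, clusterCapIn_eq]
  have hDsub : D ⊆ Λ := Finset.filter_subset _ _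
  calc clusterMaxIn Λ ω ^ 2 = ∑ _x ∈ D, clusterMaxIn Λ ω := by
        rw [Finset.sum_const, smul_eq_mul, hDcard, sq]
    _ = ∑ x ∈ D, clusterCapIn Λ ω x := Finset.sum_congr rfl fun x hx => by
        rw [hmax]; exact clusterCapIn_eq_of_reachable Λ (Finset.mem_filter.1 hx).2
    _ ≤ ∑ x ∈ Λ, clusterCapIn Λ ω x :=
        Finset.sum_le_sum_of_subset_of_nonneg hDsub fun _ _ _ => Nat.zero_le _

/-- `|K_x ∩ Λ|` as a sum of indicators of connection events. [folklore] -/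
theorem clusterCapIn_eq_sum_indicator (Λ : Finset V) (ω : BondConfig V) (x : V) :
    (clusterCapIn Λ ω x : ℝ) = ∑ y ∈ Λ, (openConn x y).indicator (fun _ => (1 : ℝ)) ω := by
  classical
  rw [clusterCapIn_eq]
  simp only [Set.indicator_apply, openConn, Set.mem_setOf_eq, Finset.sum_boole]

/-- **`E|K_x ∩ Λ| = Σ_{y ∈ Λ} P(x ↔ y)`** ((2.11)). [cite: Hutchcroft2022, §2.3 (2.11)] -/
theorem integral_clusterCapIn_eq_sum [Countable V] (μ : Measure (BondConfig V)) [IsFiniteMeasure μ]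
    (Λ : Finset V) (x : V) :
    ∫ ω, (clusterCapIn Λ ω x : ℝ) ∂μ = ∑ y ∈ Λ, μ.real (openConn x y) := by
  simp_rw [clusterCapIn_eq_sum_indicator]
  rw [integral_finsetSum _ fun y _ =>
    (integrable_const (1 : ℝ)).indicator (measurableSet_openConn_holds x y)]
  exact Finset.sum_congr rfl fun y _ => by
    rw [integral_indicator_const _ (measurableSet_openConn_holds x y), smul_eq_mul, mul_one]

/-- `ω ↦ |K_x ∩ Λ|` is integrable (finite measure). [folklore] -/
theorem integrable_clusterCapIn [Countable V] (μ : Measure (BondConfig V)) [IsFiniteMeasure μ]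
    (Λ : Finset V) (x : V) : Integrable (fun ω => (clusterCapIn Λ ω x : ℝ)) μ := by
  simp_rw [clusterCapIn_eq_sum_indicator]
  exact integrable_finsetSum _ fun y _ =>
    (integrable_const (1 : ℝ)).indicator (measurableSet_openConn_holds x y)

/-- **`(M(Λ) - 1)²/e ≤ Σ_{x,y ∈ Λ} P(x ↔ y)`**: `P(|K_max| ≥ M - 1) > 1/e` and
`|K_max|² ≤ Σ_x |K_x ∩ Λ|` ("`E[|K^max_{B_m}|²]` … by transitivity and Jensen's inequality").
[cite: Hutchcroft2022, proof of Prop. 2.4 (p. 10)] -/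
theorem sq_typicalMax_le_sum_real_openConn [Countable V] [DecidableEq V] (μ : Measure (BondConfig V))
    [IsProbabilityMeasure μ] {Λ : Finset V} (hΛ : Λ.Nonempty) :
    ((typicalMax μ Λ : ℝ) - 1) ^ 2 * Real.exp (-1) ≤ ∑ x ∈ Λ, ∑ y ∈ Λ, μ.real (openConn x y) := by
  classical
  set M := typicalMax μ Λ with hM
  have hM2 : 2 ≤ M := two_le_typicalMax μ hΛ
  have hprob : Real.exp (-1) < μ.real {ω | M - 1 ≤ clusterMaxIn Λ ω} :=
    exp_neg_one_lt_real_of_lt_typicalMax μ Λ (by omega)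
  set E : Set (BondConfig V) := {ω | M - 1 ≤ clusterMaxIn Λ ω} with hE
  have hmeas : MeasurableSet E := measurableSet_clusterMaxIn_ge Λ _
  have hM1 : (0 : ℝ) ≤ (M : ℝ) - 1 := by
    have : (2 : ℝ) ≤ M := by exact_mod_cast hM2
    linarith
  -- pointwise
  have hpt : ∀ ω, ((M : ℝ) - 1) ^ 2 * E.indicator (fun _ => (1 : ℝ)) ω ≤
      ∑ x ∈ Λ, (clusterCapIn Λ ω x : ℝ) := by
    intro ω
    by_cases h : ω ∈ E
    · rw [Set.indicator_of_mem h, mul_one]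
      have h' : M - 1 ≤ clusterMaxIn Λ ω := h
      have h1 : (M : ℝ) - 1 ≤ clusterMaxIn Λ ω := by
        have : ((M - 1 : ℕ) : ℝ) ≤ clusterMaxIn Λ ω := by exact_mod_cast h'
        rwa [Nat.cast_sub (by omega : 1 ≤ M), Nat.cast_one] at this
      have h2 : ((clusterMaxIn Λ ω : ℝ)) ^ 2 ≤ ∑ x ∈ Λ, (clusterCapIn Λ ω x : ℝ) := by
        exact_mod_cast sq_clusterMaxIn_le_sum_clusterCapIn Λ ω
      exact le_trans (pow_le_pow_left₀ hM1 h1 2) h2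
    · rw [Set.indicator_of_notMem h, mul_zero]
      exact Finset.sum_nonneg fun x _ => Nat.cast_nonneg _
  have hint1 : Integrable (fun ω => ((M : ℝ) - 1) ^ 2 * E.indicator (fun _ => (1 : ℝ)) ω) μ :=
    ((integrable_const (1 : ℝ)).indicator hmeas).const_mul _
  have hint2 : Integrable (fun ω => ∑ x ∈ Λ, (clusterCapIn Λ ω x : ℝ)) μ :=
    integrable_finsetSum _ fun x _ => integrable_clusterCapIn μ Λ x
  have hmono := integral_mono hint1 hint2 hpt
  rw [integral_const_mul, integral_indicator_const _ hmeas, smul_eq_mul, mul_one,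
    integral_finsetSum _ fun x _ => integrable_clusterCapIn μ Λ x] at hmono
  simp_rw [integral_clusterCapIn_eq_sum] at hmono
  calc ((M : ℝ) - 1) ^ 2 * Real.exp (-1) ≤ ((M : ℝ) - 1) ^ 2 * μ.real E :=
        mul_le_mul_of_nonneg_left hprob.le (sq_nonneg _)
    _ ≤ _ := hmono

variable {L : ℕ} {o : ℕ → Site d} {J : Sym2 (Site d) → ℝ} {c α β : ℝ}

/-- **`P_{β,σ}(x ↔ y in η_B) ≤ P_β(x ↔ y)`**: `η_B` is a subconfiguration of the full configuration
`η_{ℤ^d}`, whose law is `P_β` ("Bounding the volume of the entire cluster … by the volume of the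
intersection of its cluster in `η_{B_m}` with `B_m`"). [cite: Hutchcroft2022, proof of Prop. 2.4 (p. 10)] -/
theorem etaLaw_real_openConn_le (hL : 2 ≤ L) (ho : IsHierOffset L o) (hc : 0 ≤ c)
    (hα : 0 ≤ (d : ℝ) + α) (hJ0 : ∀ e, 0 ≤ J e) (hJ : HasPowerLowerBound J c α) (hβ : 0 ≤ β)
    (B : Finset (Site d)) (x y : Site d) :
    (etaLaw J L o c α β B).real (openConn x y) ≤ (kernelPercolation J β).real (openConn x y) := by
  have hL1 : 1 ≤ L := le_trans (by norm_num) hL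
  rw [← hierLaw_map_etaCfg_univ hL1 ho hc hα hJ0 hJ hβ, etaLaw, measureReal_def, measureReal_def,
    Measure.map_apply (measurable_etaCfg _) (measurableSet_openConn_holds x y),
    Measure.map_apply (measurable_etaCfg _) (measurableSet_openConn_holds x y)]
  refine ENNReal.toReal_mono (measure_ne_top _ _) (measure_mono fun ξ hξ => ?_)
  simp only [Set.mem_preimage, openConn, Set.mem_setOf_eq] at hξ ⊢
  refine hξ.mono (openGraph_mono fun e he => ?_)
  simp only [etaCfg, Set.mem_setOf_eq] at he ⊢
  exact he.imp id fun h => ⟨h.1, Set.mem_univ _⟩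

/-! ### Blocks that are good up to a level -/

/-- **Good up to level `N`**: `B_k(x)` is a good child of `B_{k+1}(x)` for every `n ≤ k < N` (a
finite-height version of "ancestrally good": the runaway arguments of Props. 2.4 and 2.7 only climb
finitely many levels, to a height depending on `β`). [cite: Hutchcroft2022, §2.2 (p. 8, ancestrally good)] -/
def IsGoodUpTo (J : Sym2 (Site d) → ℝ) (L : ℕ) (o : ℕ → Site d) (c α β : ℝ) (n N : ℕ)
    (x : Site d) : Prop :=
  ∀ k, n ≤ k → k < N → IsGood J L o c α β k x (block L o k x)

/-- Ancestrally good blocks are good up to every level. [cite: Hutchcroft2022, §2.2 (p. 8)] -/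
theorem IsAncestrallyGood.isGoodUpTo {n : ℕ} {x : Site d} (h : IsAncestrallyGood J L o c α β n x)
    (N : ℕ) : IsGoodUpTo J L o c α β n N x :=
  fun k hk _ => h k hk

/-- Monotonicity in the window. [folklore] -/
theorem IsGoodUpTo.mono {n n' N N' : ℕ} {x : Site d} (h : IsGoodUpTo J L o c α β n N x)
    (hn : n ≤ n') (hN : N' ≤ N) : IsGoodUpTo J L o c α β n' N' x :=
  fun k hk hkN => h k (le_trans hn hk) (lt_of_lt_of_le hkN hN)

/-- The children of `B_{n+1}(x)` only depend on that block. [folklore] -/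
theorem children_eq_of_mem_block (hL1 : 1 ≤ L) {n : ℕ} {x y : Site d}
    (hy : y ∈ block L o (n + 1) x) : children L o n y = children L o n x := by
  unfold children; rw [(block_eq_iff_mem hL1 o).2 hy]

/-- Goodness of a child only depends on the parent block. [folklore] -/
theorem isGood_iff_of_mem_block (hL1 : 1 ≤ L) {n : ℕ} {x y : Site d}
    (hy : y ∈ block L o (n + 1) x) (B : Finset (Site d)) :
    IsGood J L o c α β n y B ↔ IsGood J L o c α β n x B := by
  unfold IsGood; rw [children_eq_of_mem_block hL1 hy]

/-- **Blocks good up to level `N` exist below every `N`-block** (descend through good children,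
Lemma 2.1). [cite: Hutchcroft2022, proof of Prop. 2.2 ("By picking good children of good children
recursively …")] -/
theorem exists_isGoodUpTo (hL : 2 ≤ L) (hd : 1 ≤ d) (ho : IsHierOffset L o) (N : ℕ) (x₀ : Site d) :
    ∀ n, n ≤ N → ∃ x ∈ block L o N x₀, IsGoodUpTo J L o c α β n N x := by
  classical
  have hL1 : 1 ≤ L := le_trans (by norm_num) hL
  intro n hn
  induction hn using Nat.decreasingInduction with
  | self => exact ⟨x₀, mem_block_self hL1 o N x₀, fun k hk hkN => absurd hkN (not_lt.2 hk)⟩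
  | of_succ m hm ih =>
    obtain ⟨x, hx, hgood⟩ := ih
    -- a good child of `B_{m+1}(x)`
    have hcard := card_good_children_ge hL hd ho J c α β m x
    have hpos : 0 < ((children L o m x).filter fun B => IsGood J L o c α β m x B).card := by
      have h2 : L ^ d / 2 < L ^ d := Nat.div_lt_self (pow_pos (by omega) d) one_lt_two
      omega
    obtain ⟨B, hB⟩ := Finset.card_pos.1 hpos
    obtain ⟨hBC, hBgood⟩ := Finset.mem_filter.1 hB
    obtain ⟨y, hy, rfl⟩ := (mem_children_iff o).1 hBC
    refine ⟨y, ?_, fun k hk hkN => ?_⟩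
    · -- `y ∈ B_{m+1}(x) ⊆ B_N(x) = B_N(x₀)`
      have hsub : block L o (m + 1) x ⊆ block L o N x := block_mono hL1 o ho hm x
      rw [← (block_eq_iff_mem hL1 o).2 hx]
      exact hsub hy
    · rcases (show m = k ∨ m + 1 ≤ k by omega) with rfl | hk'
      · exact (isGood_iff_of_mem_block hL1 hy _).2 hBgood
      · -- higher levels: the blocks of `y` and `x` coincide
        have hyk : y ∈ block L o (k + 1) x := block_mono hL1 o ho (by omega) x hy
        have hyk' : y ∈ block L o k x := block_mono hL1 o ho hk' x hy
        rw [(block_eq_iff_mem hL1 o).2 hyk']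
        exact (isGood_iff_of_mem_block hL1 hyk _).2 (hgood k hk' hkN)

/-- **Proposition 2.4** (no runaway growth of `M_B`), finite-height form: there is `L₀ = L₀(d,α) ≥ 2`
and, for `L ≥ L₀`, `A = A(d,L,α) > 0` such that for every `0 < β < β_c` and offsets `σ` there is
a height `N₀` with `M_{B_n(x)}² < (A/(cβ)) L^{(d+α)n}` whenever `B_k(x)` is a good child of
`B_{k+1}(x)` for all `n ≤ k < N`, `N ≥ N₀` (in particular for every ancestrally good `B_n(x)`, the
printed statement; kernel `J ≥ c‖·‖^{-d-α}` translation invariant and integrable, so that the phase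
transition is sharp). Proof as printed: otherwise Lemma 2.6 iterates to
`M_{B_m}² ≥ (A/(cβ))L^{(d+α)m}` up to `m = N`, while `(M_{B_m}-1)²/e ≤ Σ_{x,y ∈ B_m} P_β(x ↔ y) ≤ C L^{dm}`
by sharpness (`E_β|K| < ∞`), which is absurd once `L^{αm}` is large.
[cite: Hutchcroft2022, Proposition 2.4 and its proof (p. 10)] -/
theorem Mblock_sq_lt_of_isGoodUpTo (hd : 1 ≤ d) (hα0 : 0 < α) (hαd : α < d) :
    ∃ L₀ : ℕ, 2 ≤ L₀ ∧ ∀ L : ℕ, L₀ ≤ L → ∃ A : ℝ, 0 < A ∧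
      ∀ (o : ℕ → Site d), IsHierOffset L o → ∀ (J : Sym2 (Site d) → ℝ) (c β : ℝ), 0 < c → 0 < β →
        β < kernelCriticalBeta J → (∀ e, 0 ≤ J e) → IsTranslationInvariantKernel J →
        IsIntegrableKernel J → HasPowerLowerBound J c α →
        ∃ N₀ : ℕ, ∀ (n N : ℕ) (x : Site d), N₀ ≤ N → IsGoodUpTo J L o c α β n N x →
          (Mblock J L o c α β (block L o n x) : ℝ) ^ 2 < A / (c * β) * (L : ℝ) ^ (((d : ℝ) + α) * n) := by
  have hα : 0 ≤ (d : ℝ) + α := by positivity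
  obtain ⟨L₀, hL₀2, hstep⟩ := Mblock_sq_renormalisation hd hα hαd
  refine ⟨L₀, hL₀2, fun L hLL => ?_⟩
  obtain ⟨A, hA, hren⟩ := hstep L hLL
  refine ⟨A, hA, ?_⟩
  intro o ho J c β hc hβ hβc hJ0 hT hI hJ
  have hL : 2 ≤ L := le_trans hL₀2 hLL
  have hL1 : 1 ≤ L := le_trans (by norm_num) hL
  have hℓ : (0 : ℝ) < L := by exact_mod_cast (by omega : 0 < L)
  -- sharpness
  obtain ⟨C, hC⟩ := exists_sum_real_openConn_le_of_lt_criticalBeta hJ0 hT hI hβ.le hβc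
  -- the bound `M_{B_m(x)}² ≤ 4e C L^{dm}` for every block
  have hbound : ∀ (m : ℕ) (x : Site d), (Mblock J L o c α β (block L o m x) : ℝ) ^ 2 ≤
      4 * Real.exp 1 * C * (L : ℝ) ^ (d * m) := by
    intro m x
    set Bm := block L o m x with hBm
    have hne : Bm.Nonempty := ⟨x, mem_block_self hL1 o m x⟩
    have h1 := sq_typicalMax_le_sum_real_openConn (etaLaw J L o c α β Bm) hne
    have h2 : ∑ a ∈ Bm, ∑ b ∈ Bm, (etaLaw J L o c α β Bm).real (openConn a b) ≤ Bm.card * C :=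
      calc ∑ a ∈ Bm, ∑ b ∈ Bm, (etaLaw J L o c α β Bm).real (openConn a b)
          ≤ ∑ a ∈ Bm, ∑ b ∈ Bm, (kernelPercolation J β).real (openConn a b) :=
            Finset.sum_le_sum fun a _ => Finset.sum_le_sum fun b _ =>
              etaLaw_real_openConn_le hL ho hc.le hα hJ0 hJ hβ.le Bm a b
        _ ≤ ∑ _a ∈ Bm, C := Finset.sum_le_sum fun a _ => hC Bm a
        _ = Bm.card * C := by rw [Finset.sum_const, nsmul_eq_mul]
    have hcard : (Bm.card : ℝ) = (L : ℝ) ^ (d * m) := by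
      rw [hBm, card_block o m x]; push_cast; rw [← pow_mul']
    have hM2 : (2 : ℝ) ≤ Mblock J L o c α β Bm := by
      unfold Mblock; exact_mod_cast two_le_typicalMax _ hne
    have hMdef : (Mblock J L o c α β Bm : ℝ) = typicalMax (etaLaw J L o c α β Bm) Bm := by rfl
    rw [← hMdef] at h1
    have he : 0 < Real.exp (-1) := Real.exp_pos _
    have hene : Real.exp 1 ≠ 0 := (Real.exp_pos 1).ne'
    have h3 : ((Mblock J L o c α β Bm : ℝ) / 2) ^ 2 ≤ ((Mblock J L o c α β Bm : ℝ) - 1) ^ 2 :=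
      pow_le_pow_left₀ (by positivity) (by linarith) 2
    rw [hcard] at h2
    have h4 : ((Mblock J L o c α β Bm : ℝ) / 2) ^ 2 * Real.exp (-1) ≤ (L : ℝ) ^ (d * m) * C :=
      (mul_le_mul_of_nonneg_right h3 he.le).trans (h1.trans h2)
    calc (Mblock J L o c α β Bm : ℝ) ^ 2
        = 4 * Real.exp 1 * (((Mblock J L o c α β Bm : ℝ) / 2) ^ 2 * Real.exp (-1)) := by
          rw [Real.exp_neg]; field_simp; norm_num
      _ ≤ 4 * Real.exp 1 * ((L : ℝ) ^ (d * m) * C) := mul_le_mul_of_nonneg_left h4 (by positivity)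
      _ = 4 * Real.exp 1 * C * (L : ℝ) ^ (d * m) := by ring
  -- from `(A/(cβ)) L^{(d+α)m} ≤ M_{B_m}²` we get `(L^α)^m ≤ K := 4eC cβ/A`
  have hK : ∀ (m : ℕ) (x : Site d), A / (c * β) * (L : ℝ) ^ (((d : ℝ) + α) * m) ≤
      (Mblock J L o c α β (block L o m x) : ℝ) ^ 2 →
      ((L : ℝ) ^ α) ^ m ≤ 4 * Real.exp 1 * C * (c * β) / A := by
    intro m x hm
    have h1 := hm.trans (hbound m x)
    have hsplit : (L : ℝ) ^ (((d : ℝ) + α) * (m : ℝ)) = (L : ℝ) ^ (d * m) * ((L : ℝ) ^ α) ^ m := by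
      have e1 : ((d : ℝ) + α) * (m : ℝ) = ((d * m : ℕ) : ℝ) + α * (m : ℝ) := by push_cast; ring
      rw [e1, Real.rpow_add hℓ, Real.rpow_natCast, Real.rpow_mul hℓ.le, Real.rpow_natCast]
    rw [hsplit] at h1
    have hpos : 0 < (L : ℝ) ^ (d * m) := pow_pos hℓ _
    have hcβ : 0 < c * β := mul_pos hc hβ
    have h2 : A / (c * β) * ((L : ℝ) ^ α) ^ m ≤ 4 * Real.exp 1 * C := by
      have h1' : (A / (c * β) * ((L : ℝ) ^ α) ^ m) * (L : ℝ) ^ (d * m) ≤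
          (4 * Real.exp 1 * C) * (L : ℝ) ^ (d * m) :=
        calc _ = A / (c * β) * ((L : ℝ) ^ (d * m) * ((L : ℝ) ^ α) ^ m) := by ring
          _ ≤ _ := h1
      exact le_of_mul_le_mul_right h1' hpos
    have h3 : A * ((L : ℝ) ^ α) ^ m ≤ 4 * Real.exp 1 * C * (c * β) := by
      have := mul_le_mul_of_nonneg_right h2 hcβ.le
      calc A * ((L : ℝ) ^ α) ^ m = A / (c * β) * ((L : ℝ) ^ α) ^ m * (c * β) := by field_simp
        _ ≤ _ := this
    rw [le_div_iff₀ hA, mul_comm]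
    exact h3
  -- the height `N₀`: `(L^α)^{N₀} > K`
  have hLα : 1 < (L : ℝ) ^ α := Real.one_lt_rpow (by exact_mod_cast hL) hα0
  obtain ⟨N₀, hN₀⟩ := pow_unbounded_of_one_lt (4 * Real.exp 1 * C * (c * β) / A) hLα
  refine ⟨N₀, fun n N x hN hgood => ?_⟩
  by_contra hnot
  push Not at hnot
  -- climb from `n` to `max n N` with Lemma 2.6
  have hclimb : ∀ k : ℕ, n + k ≤ max n N → A / (c * β) * (L : ℝ) ^ (((d : ℝ) + α) * ((n + k : ℕ) : ℝ)) ≤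
      (Mblock J L o c α β (block L o (n + k) x) : ℝ) ^ 2 := by
    intro k
    induction k with
    | zero => intro _; simpa using hnot
    | succ k ih =>
      intro hk
      have hkN : n + k < N := by omega
      have hg : IsGood J L o c α β (n + k) x (block L o (n + k) x) := hgood (n + k) (by omega) hkN
      have := hren o ho J c β hc hβ hJ0 hJ (n + k) x (block L o (n + k) x) hg (ih (by omega))
      rw [show n + (k + 1) = n + k + 1 from (Nat.add_assoc n k 1).symm]
      convert this using 3
      push_cast; ring
  have htop := hclimb (max n N - n) (by omega)
  rw [show n + (max n N - n) = max n N by omega] at htop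
  have h1 := hK (max n N) x htop
  have h2 : ((L : ℝ) ^ α) ^ N₀ ≤ ((L : ℝ) ^ α) ^ (max n N) :=
    pow_le_pow_right₀ hLα.le (le_trans hN (le_max_right _ _))
  linarith

/-- **Proposition 2.4, printed form** (ancestrally good blocks). [cite: Hutchcroft2022, Proposition 2.4] -/
theorem Mblock_sq_lt_of_ancestrallyGood (hd : 1 ≤ d) (hα0 : 0 < α) (hαd : α < d) :
    ∃ L₀ : ℕ, 2 ≤ L₀ ∧ ∀ L : ℕ, L₀ ≤ L → ∃ A : ℝ, 0 < A ∧
      ∀ (o : ℕ → Site d), IsHierOffset L o → ∀ (J : Sym2 (Site d) → ℝ) (c β : ℝ), 0 < c → 0 < β →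
        β < kernelCriticalBeta J → (∀ e, 0 ≤ J e) → IsTranslationInvariantKernel J →
        IsIntegrableKernel J → HasPowerLowerBound J c α →
        ∀ (n : ℕ) (x : Site d), IsAncestrallyGood J L o c α β n x →
          (Mblock J L o c α β (block L o n x) : ℝ) ^ 2 < A / (c * β) * (L : ℝ) ^ (((d : ℝ) + α) * n) := by
  obtain ⟨L₀, hL₀2, h⟩ := Mblock_sq_lt_of_isGoodUpTo hd hα0 hαd
  refine ⟨L₀, hL₀2, fun L hLL => ?_⟩
  obtain ⟨A, hA, h⟩ := h L hLL
  refine ⟨A, hA, fun o ho J c β hc hβ hβc hJ0 hT hI hJ n x hgood => ?_⟩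
  obtain ⟨N₀, hN₀⟩ := h o ho J c β hc hβ hβc hJ0 hT hI hJ
  exact hN₀ n N₀ x le_rfl (hgood.isGoodUpTo N₀)

end NoRunaway


end Literature.Probability.Percolation

end
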